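import Summits.AnomalousDissipation.AnomalousDissipation.Theorems.SolenoidalFractalHomogenisationLagrangianStepSinePhase
import Literature.Analysis.FluidPDE.PassiveVectorTensorPropagatorEnergy
import HarnessLib

/-!
# K1L_D (stmt-AnomalousDissipation-27980), line «onelevel-design», brick Z4♭: the mode coefficients of a WEAKLY CONTINUOUS `V2`-valued family are
# continuous — the a.e.-in-time modewise bounds of (V) hold at EVERY window end (helper; `--supports … --as helper`; lead-k1l-onelevel-p1 g4)

`…CellTimeModewise.ae_modeCoeff_window_sub_sq_le` bounds `2Σᵢ|modeCoeff ℓ (Um1 s (s+t'/a) x − Um s (s+t'/a) x) i|²` for a.e. cell time `t'`;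
the window end `s'` of the registered texts is ONE time.  THIS FILE:
* `modeCoeff_coe_eq_inner` — `modeCoeff ℓ (⇑z) i = ⟪z, x_c(eᵢ)⟫ − i·⟪z, x_s(eᵢ)⟫` (`x_c/x_s` the cosine/sine single modes of `…SinePhase`), so
* `continuousOn_modeCoeff_of_weakly_continuous` — if every pairing `t ↦ ⟪F t, z⟫` is continuous on an interval then so is `t ↦ modeCoeff ℓ (F t) i`,
  and `continuousOn_sum_norm_sq_modeCoeff` — so is `t ↦ 2Σᵢ‖modeCoeff ℓ (F t) i‖²`;
* **`continuousOn_modeCoeff_propagator_sub`** — for two `Torus.IsPropagator` families, `t ↦ modeCoeff ℓ (U₁ s t x − U₂ s t x) i` is continuous on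
  `[s, T₀]` (`IsPropagator.continuousOn`);
* the upgrade itself is `Torus.IsPropagator.le_on_Icc_of_ae_le_of_continuousOn₂` (Literature `PassiveVectorTensorPropagatorEnergy`).
NOT a proof of Z4♭, of any registered stub, of the crux, or of AD; rung F-D1.A0.
-/

set_option linter.dupNamespace false  -- the summit-side namespace `Summit.AnomalousDissipation.AnomalousDissipation.…` repeats a component by design (D-0017)

noncomputable section

namespace Summit.AnomalousDissipation.AnomalousDissipation.Theorems.SolenoidalFractalHomogenisation.LagrangianStep.PropagatorSymm

open Literature.Analysis Literature.Analysis.FluidPDE Literature.Analysis.FluidPDE.Torus Literature.Analysis.FunctionSpaces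
open MeasureTheory Set Filter UnitAddTorus Function Complex
open scoped ENNReal NNReal InnerProductSpace
open OneLevelSplit
open WindowDuality (inner_toLp_left)

/-! ## `modeCoeff` as two real pairings -/

/-- `⟪z, toLp g⟫ = ∫ ⟪z x, g x⟫`. -/
theorem inner_toLp_right {g : VF} (hg : MemLp g 2 volume) (z : V2) : ⟪z, hg.toLp g⟫_ℝ = ∫ x, ⟪(z : VF) x, g x⟫_ℝ := by
  rw [real_inner_comm, inner_toLp_left hg z]
  exact integral_congr_ae (ae_of_all _ fun x => real_inner_comm _ _)

/-- **`modeCoeff` through real pairings**: `modeCoeff ℓ (⇑z) i = ⟪z, x_c(eᵢ)⟫ − i ⟪z, x_s(eᵢ)⟫`. -/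
theorem modeCoeff_coe_eq_inner (ℓ : Fin 3 → ℤ) (i : Fin 3) (z : V2) :
    modeCoeff ℓ (z : VF) i
      = ((⟪z, (memLp_cosMode ℓ (EuclideanSpace.single i (1:ℝ))).toLp _⟫_ℝ : ℝ) : ℂ)
        - I * ((⟪z, (memLp_sinMode ℓ (EuclideanSpace.single i (1:ℝ))).toLp _⟫_ℝ : ℝ) : ℂ) := by
  rw [inner_toLp_right, inner_toLp_right]
  simp only [real_inner_smul_right, EuclideanSpace.inner_single_right, conj_trivial, one_mul]
  unfold modeCoeff
  -- integrability of the two real integrands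
  have hzi : Integrable (fun x => (z : VF) x i) volume := by
    have h := integrable_coe_V2 z
    exact (EuclideanSpace.proj (𝕜 := ℝ) (ι := Fin 3) i).integrable_comp h
  have hc : Continuous fun x : UnitAddTorus (Fin 3) => (mFourier ℓ x) := (mFourier ℓ).continuous
  have hbd : ∀ x : UnitAddTorus (Fin 3), ‖mFourier ℓ x‖ ≤ 1 := fun x =>
    (ContinuousMap.norm_coe_le_norm (mFourier ℓ) x).trans (by rw [mFourier_norm])
  have hre : Integrable (fun x => (mFourier ℓ x).re * (z : VF) x i) volume := by
    refine Integrable.mono' (hzi.norm) ((Complex.continuous_re.comp hc).aestronglyMeasurable.mul hzi.1) (ae_of_all _ fun x => ?_)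
    rw [norm_mul, Real.norm_eq_abs]
    exact mul_le_of_le_one_left (norm_nonneg _) ((Complex.abs_re_le_norm _).trans (hbd x))
  have him : Integrable (fun x => (mFourier ℓ x).im * (z : VF) x i) volume := by
    refine Integrable.mono' (hzi.norm) ((Complex.continuous_im.comp hc).aestronglyMeasurable.mul hzi.1) (ae_of_all _ fun x => ?_)
    rw [norm_mul, Real.norm_eq_abs]
    exact mul_le_of_le_one_left (norm_nonneg _) ((Complex.abs_im_le_norm _).trans (hbd x))
  -- split the complex integrand
  have e : (fun x => (starRingEnd ℂ) (mFourier ℓ x) * (((z : VF) x i : ℝ) : ℂ))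
      = fun x => (((mFourier ℓ x).re * (z : VF) x i : ℝ) : ℂ) - I * (((mFourier ℓ x).im * (z : VF) x i : ℝ) : ℂ) := by
    funext x
    apply Complex.ext <;> simp [Complex.conj_re, Complex.conj_im]
  have hre' : Integrable (fun x => ((((mFourier ℓ x).re * (z : VF) x i : ℝ)) : ℂ)) volume := hre.ofReal
  have him' : Integrable (fun x => I * ((((mFourier ℓ x).im * (z : VF) x i : ℝ)) : ℂ)) volume := him.ofReal.const_mul I
  rw [e, integral_sub hre' him', integral_const_mul, integral_complex_ofReal, integral_complex_ofReal]

/-! ## Continuity -/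

/-- If every pairing of `F` is continuous on `I`, then `t ↦ modeCoeff ℓ (F t) i` is continuous on `I`. -/
theorem continuousOn_modeCoeff_of_weakly_continuous {F : ℝ → V2} {Iv : Set ℝ}
    (hF : ∀ z : V2, ContinuousOn (fun t => ⟪F t, z⟫_ℝ) Iv) (ℓ : Fin 3 → ℤ) (i : Fin 3) :
    ContinuousOn (fun t => modeCoeff ℓ ((F t : V2) : VF) i) Iv := by
  have e : (fun t => modeCoeff ℓ ((F t : V2) : VF) i) = fun t =>
      ((⟪F t, (memLp_cosMode ℓ (EuclideanSpace.single i (1:ℝ))).toLp _⟫_ℝ : ℝ) : ℂ)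
        - I * ((⟪F t, (memLp_sinMode ℓ (EuclideanSpace.single i (1:ℝ))).toLp _⟫_ℝ : ℝ) : ℂ) := by
    funext t; exact modeCoeff_coe_eq_inner ℓ i (F t)
  rw [e]
  exact ((Complex.continuous_ofReal.comp_continuousOn (hF _)).sub
    (continuousOn_const.mul (Complex.continuous_ofReal.comp_continuousOn (hF _))))

/-- … hence `t ↦ 2Σᵢ‖modeCoeff ℓ (F t) i‖²` is continuous on `I`. -/
theorem continuousOn_sum_norm_sq_modeCoeff {F : ℝ → V2} {Iv : Set ℝ}
    (hF : ∀ z : V2, ContinuousOn (fun t => ⟪F t, z⟫_ℝ) Iv) (ℓ : Fin 3 → ℤ) :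
    ContinuousOn (fun t => 2 * ∑ i, ‖modeCoeff ℓ ((F t : V2) : VF) i‖ ^ 2) Iv :=
  continuousOn_const.mul (continuousOn_finsetSum _ fun i _ => ((continuousOn_modeCoeff_of_weakly_continuous hF ℓ i).norm).pow 2)

variable {T₀ : ℝ} {b₁ b₂ : ℝ → VF} {𝔸₁ 𝔸₂ : Torus.Visc4 (Fin 3)} {U₁ U₂ : ℝ → ℝ → (V2 →L[ℝ] V2)}

/-- **Weak continuity of the window error of two propagator families**: every pairing `t ↦ ⟪U₁ s t x − U₂ s t x, z⟫` is continuous on `[s, T₀]`. -/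
theorem continuousOn_inner_propagator_sub (hU₁ : Torus.IsPropagator T₀ b₁ 𝔸₁ U₁) (hU₂ : Torus.IsPropagator T₀ b₂ 𝔸₂ U₂)
    {s : ℝ} (hs : 0 ≤ s) (hsT : s ≤ T₀) (x z : V2) :
    ContinuousOn (fun t => ⟪U₁ s t x - U₂ s t x, z⟫_ℝ) (Icc s T₀) := by
  have e : (fun t => ⟪U₁ s t x - U₂ s t x, z⟫_ℝ) = fun t => ⟪U₁ s t x, z⟫_ℝ - ⟪U₂ s t x, z⟫_ℝ := by
    funext t; exact inner_sub_left _ _ _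
  rw [e]
  exact (hU₁.continuousOn s hs hsT x z).sub (hU₂.continuousOn s hs hsT x z)

/-- **The modewise window-error functional is continuous in the window end.** -/
theorem continuousOn_sum_norm_sq_modeCoeff_propagator_sub (hU₁ : Torus.IsPropagator T₀ b₁ 𝔸₁ U₁) (hU₂ : Torus.IsPropagator T₀ b₂ 𝔸₂ U₂)
    {s : ℝ} (hs : 0 ≤ s) (hsT : s ≤ T₀) (x : V2) (ℓ : Fin 3 → ℤ) :
    ContinuousOn (fun t => 2 * ∑ i, ‖modeCoeff ℓ ((U₁ s t x - U₂ s t x : V2) : VF) i‖ ^ 2) (Icc s T₀) :=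
  continuousOn_sum_norm_sq_modeCoeff (fun z => continuousOn_inner_propagator_sub hU₁ hU₂ hs hsT x z) ℓ

end Summit.AnomalousDissipation.AnomalousDissipation.Theorems.SolenoidalFractalHomogenisation.LagrangianStep.PropagatorSymm

end
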